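import Literature.NumberTheory.Rogawski1990.LocalClassMapRealisationNonsplit     -- ★ F4c-2a (this seat): admissible set, realisation by semisimple `ε_H`, saturation (F4b)
import Literature.NumberTheory.Rogawski1990.LocalStableOrbitalIntegralGlue        -- ★ ENGINE (this seat): `exists_stableOrbitalIntegralRel_eq_of_pointwise_of_saturation`
import Literature.NumberTheory.Rogawski1990.LocalTransferRegularCutoff            -- ★ `classOrbitalIntegral_congr_of_forall_conj`
import Literature.NumberTheory.Rogawski1990.LocalTransferExplicitNonsplit         -- ★ the letter's currency: `finExplicitCollection`, `finExplicitDelta_conj_*_all`, `IsCanonical`, …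
import Literature.LinearAlgebra.Matrix.CharpolyFactorDatumProper                 -- ★ F1 (this seat): `isCompact_of_isClosed_of_factorDatum_subset`, `coeff_mul_X_sub_C_of_monic_natDegree_two`
import HarnessLib

/-!
# A LOCAL stable orbital integral on `H_v = U(Φ₂)_v × U(Φ₁)_v` is a stable orbital integral — Langlands–Shelstad, *Descent for transfer factors*,
# Lemma 2.2.A, in transfer dress at a NON-SPLIT place: the stub `stub_N6nsGlue` of the floor-2 line «N6nsGerm» (crux H413)

Topic `NumberTheory/Rogawski1990`; namespace `Literature.NumberTheory.Rogawski1990`.  THEOREMS ONLY (no definition, no instance, no notation, no named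
fact, no `sorry`).  Cell `pub/hodgecm-mathlib` (D-0151), crux H413 = stmt-HodgeConjecture-24833, F0∕P3a road «D-N6-ns», floor-2 line «N6nsGerm» (A-p12 (g18),
candidate ED. 1.1 sha16 2f8045a9193d4ad3), stub **`stub_N6nsGlue`** — SATURATION HALF + glue (LEAD F0P3a-plan (g9) WORD T8-55 → B-p08 (g26); co-architects
F0P2-p02 (g8), A-p12 (g18)).  HONEST LABEL: HC_CM is proved only modulo the 2 remaining named inputs (hLiu418, h413) until rung 0 closes; this file proves
no letter — it discharges ONE registered stub of ONE line.

THE MATHEMATICS (LS 1990 §2.2 pp. 10–11 for `U(2) × U(1)`).  `UnitaryGroup.LocalRing L vφ(γ_H) = Σ_c Δ‴_v(γ_H, c) Φ(c, φ)`.  (σ-K) `UnitaryGroup.LocalRing L vφ(γ_H) ≠ 0` forces a matching `γ` (`Δ‴ ≠ 0`) in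
the conjugacy-saturation of `tsupport φ` (`Φ ≠ 0`), so `χ_γ = χ_g·(X − u)` has its coefficients in a compact set, and the class `π(γ_H) = (coeff₀ χ_g, coeff₁ χ_g,
u)` lies in a COMPACT set `K` (★ `isCompact_of_isClosed_of_factorDatum_subset`: the roots of a monic cubic are bounded by its coefficients) inside the closed
ADMISSIBLE set (`exists_isCompact_classMapH_of_ne_zero`).  Every point of `K` is the class of a SEMISIMPLE `ε_H` (★ `exists_semisimple_classMapH_eq`), where
the hypothesis «`UnitaryGroup.LocalRing L vφ` is a local stable orbital integral» applies, and SATURATION (★ `exists_isOpen_classMapH_saturation`) spreads the local identity over the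
stably-invariant open `π⁻¹(W)`; the ENGINE ★ `exists_stableOrbitalIntegralRel_eq_of_pointwise_of_saturation` (clopen partition of `K`, cut-offs, sum) returns
`φ^H ∈ C_c^∞(H_v)` with `Φ^st(γ_H, φ^H) = UnitaryGroup.LocalRing L vφ(γ_H)` for every `G`-regular `γ_H` (`exists_isLocalDeltaTransfer_of_locally`; `stubN6nsGlue_of_hloc` is the
token-exact statement of the line's stub).

## References
* [LanglandsShelstad1990Descent] R. P. Langlands, D. Shelstad, *Descent for transfer factors*, Progr. Math. 87 (1990), §2.2 Lemma 2.2.A pp. 10–12.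
* [Rogawski1990] J. D. Rogawski, *Automorphic Representations of Unitary Groups in Three Variables*, Ann. of Math. Stud. 123 (1990), §4.3 (4.3.1) p. 43,
  §4.9 Prop. 4.9.1 pp. 54–55, §3.1 p. 19.
* [PlatonovRapinchuk1994] V. Platonov, A. Rapinchuk, *Algebraic Groups and Number Theory* (1994), §5.1.
-/

set_option autoImplicit false

noncomputable section

open NumberField IsDedekindDomain MeasureTheory Measure Matrix Polynomial Set Filter Topology
open Literature.AlgebraicGeometry.ShimuraVarieties (unitaryGroup hermForm)
open Literature.NumberTheory.GaloisRepresentations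
open scoped MatrixGroups Valued

namespace Literature.NumberTheory.Rogawski1990

open Literature.NumberTheory.Automorphic

section Local

variable (L : Type) [Field L] [NumberField L] [IsCMField L] (H' : Matrix (Fin 3) (Fin 3) L) (v : HeightOneSpectrum (𝓞 ↥(maximalRealSubfield L)))
  (w : UnitaryGroup.PlacesOver L v) (hw : IsCMField.complexConj L • w.1 = w.1)

/-! ## §1 (σ-K): `UnitaryGroup.LocalRing L vφ ≠ 0` only on classes in a compact subset of the admissible set -/

/-- **(σ-K).**  For `φ ∈ C_c^∞(G′_v)` and any transfer factor `Δ`, there is a COMPACT `K ⊆ {admissible}` in `(∏_{w∣v} L_w)³` such that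
`UnitaryGroup.LocalRing L vφ(γ_H) = Σ_c Δ(γ_H, c)·Φ(c, φ) ≠ 0` implies `π(γ_H) ∈ K`: a non-zero term needs a matching `γ` conjugate into `tsupport φ`, whose characteristic polynomial
`χ_g·(X − u)` then has coefficients in a compact set; the roots of a monic cubic are bounded by its coefficients (★ `isCompact_of_isClosed_of_factorDatum_subset`).
[cite: LanglandsShelstad1990Descent, §2.2 p. 10] [cite: Rogawski1990, §4.9 p. 54] -/
theorem exists_isCompact_classMapH_of_ne_zero [∀ γ : (UnitaryGroup.cmDatum L 3 H').Local v, MeasurableSpace ((UnitaryGroup.cmDatum L 3 H').Local v ⧸ Subgroup.centralizer ({γ} : Set ((UnitaryGroup.cmDatum L 3 H').Local v)))]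
    (T : LocalTransferFactor L H' v) (mG : OrbitalMeasureFamily ((UnitaryGroup.cmDatum L 3 H').Local v)) (φ : (UnitaryGroup.cmDatum L 3 H').Local v → ℂ) (hφ : IsLocSmooth φ) :
    ∃ K : Set ((UnitaryGroup.LocalRing L v) × (UnitaryGroup.LocalRing L v) × (UnitaryGroup.LocalRing L v)), IsCompact K ∧ K ⊆ {q : (UnitaryGroup.LocalRing L v) × (UnitaryGroup.LocalRing L v) × (UnitaryGroup.LocalRing L v) | galAdicCompletionMap (L := L) (IsCMField.complexConj L) hw (Pi.evalRingHom (fun w' : UnitaryGroup.PlacesOver L v => w'.1.adicCompletion L) w q.1) * Pi.evalRingHom (fun w' : UnitaryGroup.PlacesOver L v => w'.1.adicCompletion L) w q.1 = 1 ∧ galAdicCompletionMap (L := L) (IsCMField.complexConj L) hw (Pi.evalRingHom (fun w' : UnitaryGroup.PlacesOver L v => w'.1.adicCompletion L) w q.2.1) * Pi.evalRingHom (fun w' : UnitaryGroup.PlacesOver L v => w'.1.adicCompletion L) w q.1 = Pi.evalRingHom (fun w' : UnitaryGroup.PlacesOver L v => w'.1.adicCompletion L) w q.2.1 ∧ galAdicCompletionMap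 (L := L) (IsCMField.complexConj L) hw (Pi.evalRingHom (fun w' : UnitaryGroup.PlacesOver L v => w'.1.adicCompletion L) w q.2.2) * Pi.evalRingHom (fun w' : UnitaryGroup.PlacesOver L v => w'.1.adicCompletion L) w q.2.2 = 1} ∧
      ∀ γH : (UnitaryGroup.cmDatum L 2 (Matrix.of fun i j : Fin 2 => if i.val + j.val + 1 = 2 then (1 : L) else 0)).Local v × (UnitaryGroup.cmDatum L 1 (Matrix.of fun i j : Fin 1 => if i.val + j.val + 1 = 1 then (1 : L) else 0)).Local v, (∑ᶠ c : ConjClasses ((UnitaryGroup.cmDatum L 3 H').Local v), T.Δ γH (Quotient.out c) * classOrbitalIntegral mG φ c) ≠ 0 →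
        ((finCharpolyTwo L v γH).coeff 0, (finCharpolyTwo L v γH).coeff 1, finGammaTwo L v γH) ∈ K := by
  haveI : ∀ w' : UnitaryGroup.PlacesOver L v, ProperSpace (w'.1.adicCompletion L) := fun w' => properSpace_adicCompletion L w'.1
  -- the compact set of coefficient triples of `χ_γ`, `γ ∈ tsupport φ`
  set cf : (UnitaryGroup.cmDatum L 3 H').Local v → (UnitaryGroup.LocalRing L v) × (UnitaryGroup.LocalRing L v) × (UnitaryGroup.LocalRing L v) := fun y =>
    ((((y.val : GL (Fin 3) (UnitaryGroup.LocalRing L v))).val.charpoly).coeff 0, (((y.val : GL (Fin 3) (UnitaryGroup.LocalRing L v))).val.charpoly).coeff 1,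
      (((y.val : GL (Fin 3) (UnitaryGroup.LocalRing L v))).val.charpoly).coeff 2) with hcf
  have hM : Continuous fun y : (UnitaryGroup.cmDatum L 3 H').Local v => ((y.val : GL (Fin 3) (UnitaryGroup.LocalRing L v))).val := Units.continuous_val.comp continuous_subtype_val
  have hcfc : Continuous cf :=
    ((Literature.LinearAlgebra.Matrix.continuous_charpoly_coeff 0).comp hM).prodMk
      (((Literature.LinearAlgebra.Matrix.continuous_charpoly_coeff 1).comp hM).prodMk
        ((Literature.LinearAlgebra.Matrix.continuous_charpoly_coeff 2).comp hM))
  have hQ : IsCompact (cf '' tsupport φ) := hφ.2.isCompact.image hcfc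
  -- `K = datum⁻¹(Q) ∩ admissible`
  have hdatum : Continuous fun x : (UnitaryGroup.LocalRing L v) × (UnitaryGroup.LocalRing L v) × (UnitaryGroup.LocalRing L v) => (-(x.1 * x.2.2), x.1 - x.2.1 * x.2.2, x.2.1 - x.2.2) :=
    (continuous_fst.mul continuous_snd.snd).neg.prodMk
      ((continuous_fst.sub (continuous_snd.fst.mul continuous_snd.snd)).prodMk (continuous_snd.fst.sub continuous_snd.snd))
  refine ⟨{x | (-(x.1 * x.2.2), x.1 - x.2.1 * x.2.2, x.2.1 - x.2.2) ∈ cf '' tsupport φ} ∩ {q : (UnitaryGroup.LocalRing L v) × (UnitaryGroup.LocalRing L v) × (UnitaryGroup.LocalRing L v) | galAdicCompletionMap (L := L) (IsCMField.complexConj L) hw (Pi.evalRingHom (fun w' : UnitaryGroup.PlacesOver L v => w'.1.adicCompletion L) w q.1) * Pi.evalRingHom (fun w' : UnitaryGroup.PlacesOver L v => w'.1.adicCompletion L) w q.1 = 1 ∧ galAdicCompletionMap (L := L) (IsCMField.complexConj L) hw (Pi.evalRingHom (fun w' : UnitaryGroup.PlacesOver L v => w'.1.adicCompletion L) w q.2.1)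 * Pi.evalRingHom (fun w' : UnitaryGroup.PlacesOver L v => w'.1.adicCompletion L) w q.1 = Pi.evalRingHom (fun w' : UnitaryGroup.PlacesOver L v => w'.1.adicCompletion L) w q.2.1 ∧ galAdicCompletionMap (L := L) (IsCMField.complexConj L) hw (Pi.evalRingHom (fun w' : UnitaryGroup.PlacesOver L v => w'.1.adicCompletion L) w q.2.2) * Pi.evalRingHom (fun w' : UnitaryGroup.PlacesOver L v => w'.1.adicCompletion L) w q.2.2 = 1}, ?_, Set.inter_subset_right, fun γH hR => ?_⟩
  · refine Literature.LinearAlgebra.Matrix.isCompact_of_isClosed_of_factorDatum_subset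
      (𝕜 := fun w' : UnitaryGroup.PlacesOver L v => w'.1.adicCompletion L)
      ((hQ.isClosed.preimage hdatum).inter (isClosed_admissibleH L v w hw)) hQ fun x hx => hx.1
  · refine ⟨?_, classMapH_admissible L v w hw γH⟩
    -- a non-zero term: `Δ(γ_H, c) ≠ 0` and `Φ(c, φ) ≠ 0`
    obtain ⟨c, hc⟩ : ∃ c : ConjClasses ((UnitaryGroup.cmDatum L 3 H').Local v), T.Δ γH (Quotient.out c) * classOrbitalIntegral mG φ c ≠ 0 := by
      by_contra h
      push Not at h
      exact hR (by rw [finsum_congr h]; exact finsum_zero)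
    have hΔ : T.Δ γH (Quotient.out c) ≠ 0 := left_ne_zero_of_mul hc
    have hΦ : classOrbitalIntegral mG φ c ≠ 0 := right_ne_zero_of_mul hc
    have hrel : IsLocalNormPair L H' v γH (Quotient.out c) := by
      by_contra hn; exact hΔ (T.eq_zero_of_not_rel _ _ hn)
    -- some conjugate of `out c` lies in the support of `φ`
    obtain ⟨x, hx⟩ : ∃ x : (UnitaryGroup.cmDatum L 3 H').Local v, φ (x * Quotient.out c * x⁻¹) ≠ 0 := by
      by_contra h
      push Not at h
      apply hΦ
      rw [classOrbitalIntegral_congr_of_forall_conj mG c (F := φ) (F' := (0 : (UnitaryGroup.cmDatum L 3 H').Local v → ℂ)) (fun x => by rw [h x]; rfl)]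
      exact classOrbitalIntegral_zero_fun mG c
    have hy : x * Quotient.out c * x⁻¹ ∈ tsupport φ := subset_tsupport _ (Function.mem_support.2 hx)
    -- `χ_{x c x⁻¹} = χ_c = χ_g · (X − u)`
    have hval : ((x * Quotient.out c * x⁻¹ : (UnitaryGroup.cmDatum L 3 H').Local v).val : GL (Fin 3) (UnitaryGroup.LocalRing L v)) =
        (x.val : GL (Fin 3) (UnitaryGroup.LocalRing L v)) * ((Quotient.out c).val : GL (Fin 3) (UnitaryGroup.LocalRing L v)) * (x.val : GL (Fin 3) (UnitaryGroup.LocalRing L v))⁻¹ := rfl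
    have hconj : (((x * Quotient.out c * x⁻¹ : (UnitaryGroup.cmDatum L 3 H').Local v).val : GL (Fin 3) (UnitaryGroup.LocalRing L v))).val.charpoly =
        (((Quotient.out c).val : GL (Fin 3) (UnitaryGroup.LocalRing L v))).val.charpoly := by
      rw [hval, Units.val_mul, Units.val_mul, Matrix.coe_units_inv, Matrix.charpoly_units_conj]
    have hχ : (((x * Quotient.out c * x⁻¹ : (UnitaryGroup.cmDatum L 3 H').Local v).val : GL (Fin 3) (UnitaryGroup.LocalRing L v))).val.charpoly = finCharpolyTwo L v γH * (X - C (finGammaTwo L v γH)) :=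
      hconj.trans hrel.charpoly_eq
    have hm : (finCharpolyTwo L v γH).Monic := Matrix.charpoly_monic _
    have hd : (finCharpolyTwo L v γH).natDegree = 2 := by
      unfold finCharpolyTwo; rw [Matrix.charpoly_natDegree_eq_dim, Fintype.card_fin]
    obtain ⟨h0, h1, h2⟩ := Literature.LinearAlgebra.Matrix.coeff_mul_X_sub_C_of_monic_natDegree_two _ hm hd (finGammaTwo L v γH)
    refine ⟨x * Quotient.out c * x⁻¹, hy, ?_⟩
    simp only [hcf, hχ, h0, h1, h2]

/-! ## §2 The glue: a local stable orbital integral of the form `UnitaryGroup.LocalRing L vφ` is a stable orbital integral -/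

include w hw in
/-- **«A LOCAL STABLE ORBITAL INTEGRAL IS A STABLE ORBITAL INTEGRAL», transfer dress, non-split `v`.**  Let `Δ` be a transfer factor that is stably invariant
in `γ_H`, `φ ∈ C_c^∞(G′_v)`, and suppose `UnitaryGroup.LocalRing L vφ(γ_H) = Σ_c Δ(γ_H, c)Φ(c, φ)` is a LOCAL stable orbital integral at every `ε_H` with SEMISIMPLE `U(Φ₂)`-part
(regular semisimple or scalar).  Then `UnitaryGroup.LocalRing L vφ = Φ^st(·, φ^H)` on the `G`-regular set for some `φ^H ∈ C_c^∞(H_v)`, i.e. `φ^H` is a `Δ`-transfer of `φ`.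
Proof: (σ-K) + realisation + saturation + the engine. [cite: LanglandsShelstad1990Descent, §2.2 Lemma 2.2.A pp. 10–12] [cite: Rogawski1990, §4.3 (4.3.1) p. 43] -/
theorem exists_isLocalDeltaTransfer_of_locally
    [iH : ∀ a : (UnitaryGroup.cmDatum L 2 (Matrix.of fun i j : Fin 2 => if i.val + j.val + 1 = 2 then (1 : L) else 0)).Local v × (UnitaryGroup.cmDatum L 1 (Matrix.of fun i j : Fin 1 => if i.val + j.val + 1 = 1 then (1 : L) else 0)).Local v, MeasurableSpace (((UnitaryGroup.cmDatum L 2 (Matrix.of fun i j : Fin 2 => if i.val + j.val + 1 = 2 then (1 : L) else 0)).Local v × (UnitaryGroup.cmDatum L 1 (Matrix.of fun i j : Fin 1 => if i.val + j.val + 1 = 1 then (1 : L) else 0)).Local v) ⧸ Subgroup.centralizer ({a} : Set ((UnitaryGroup.cmDatum L 2 (Matrix.of fun i j : Fin 2 => if i.val + j.val + 1 = 2 then (1 : L) else 0)).Local v × (UnitaryGroup.cmDatum L 1 (Matrix.of fun i j : Fin 1 => if i.val + j.val + 1 = 1 then (1 : L) else 0)).Local v)))]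
    [iG : ∀ γ : (UnitaryGroup.cmDatum L 3 H').Local v, MeasurableSpace ((UnitaryGroup.cmDatum L 3 H').Local v ⧸ Subgroup.centralizer ({γ} : Set ((UnitaryGroup.cmDatum L 3 H').Local v)))]
    (T : LocalTransferFactor L H' v)
    (hT : ∀ (a a' : (UnitaryGroup.cmDatum L 2 (Matrix.of fun i j : Fin 2 => if i.val + j.val + 1 = 2 then (1 : L) else 0)).Local v × (UnitaryGroup.cmDatum L 1 (Matrix.of fun i j : Fin 1 => if i.val + j.val + 1 = 1 then (1 : L) else 0)).Local v) (b : (UnitaryGroup.cmDatum L 3 H').Local v), IsLocalStablyConjH L v a a' → T.Δ a' b = T.Δ a b)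
    (mH : OrbitalMeasureFamily ((UnitaryGroup.cmDatum L 2 (Matrix.of fun i j : Fin 2 => if i.val + j.val + 1 = 2 then (1 : L) else 0)).Local v × (UnitaryGroup.cmDatum L 1 (Matrix.of fun i j : Fin 1 => if i.val + j.val + 1 = 1 then (1 : L) else 0)).Local v)) (mG : OrbitalMeasureFamily ((UnitaryGroup.cmDatum L 3 H').Local v)) (φ : (UnitaryGroup.cmDatum L 3 H').Local v → ℂ) (hφ : IsLocSmooth φ)
    (hloc : ∀ εH : (UnitaryGroup.cmDatum L 2 (Matrix.of fun i j : Fin 2 => if i.val + j.val + 1 = 2 then (1 : L) else 0)).Local v × (UnitaryGroup.cmDatum L 1 (Matrix.of fun i j : Fin 1 => if i.val + j.val + 1 = 1 then (1 : L) else 0)).Local v,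
      (IsRegularElt (εH.1.val : GL (Fin 2) (UnitaryGroup.LocalRing L v)) ∨ ∃ a : UnitaryGroup.LocalRing L v, (εH.1.val.val : Matrix (Fin 2) (Fin 2) (UnitaryGroup.LocalRing L v)) = a • (1 : Matrix (Fin 2) (Fin 2) (UnitaryGroup.LocalRing L v))) →
      ∃ V ∈ 𝓝 εH, ∃ φH : (UnitaryGroup.cmDatum L 2 (Matrix.of fun i j : Fin 2 => if i.val + j.val + 1 = 2 then (1 : L) else 0)).Local v × (UnitaryGroup.cmDatum L 1 (Matrix.of fun i j : Fin 1 => if i.val + j.val + 1 = 1 then (1 : L) else 0)).Local v → ℂ, IsLocSmooth φH ∧ ∀ γH ∈ V, IsLocalGRegular L v γH →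
        stableOrbitalIntegralRel (IsLocalStablyConjH L v) mH φH γH = ∑ᶠ c : ConjClasses ((UnitaryGroup.cmDatum L 3 H').Local v), T.Δ γH (Quotient.out c) * classOrbitalIntegral mG φ c) :
    ∃ φH : (UnitaryGroup.cmDatum L 2 (Matrix.of fun i j : Fin 2 => if i.val + j.val + 1 = 2 then (1 : L) else 0)).Local v × (UnitaryGroup.cmDatum L 1 (Matrix.of fun i j : Fin 1 => if i.val + j.val + 1 = 1 then (1 : L) else 0)).Local v → ℂ, IsLocSmooth φH ∧ IsLocalDeltaTransfer L H' v T mH mG φH φ := by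
  haveI : TotallyDisconnectedSpace (UnitaryGroup.LocalRing L v) := totallyDisconnectedSpace_localRing L v
  obtain ⟨K, hK, hKadm, hKR⟩ := exists_isCompact_classMapH_of_ne_zero L H' v w hw T mG φ hφ
  have hπc := continuous_classMapH L v
  -- `hloc` of the engine at a point of `K`: realise it by a semisimple `ε_H`, then saturate
  have hloc' : ∀ c ∈ K, ∃ (V : Set ((UnitaryGroup.cmDatum L 2 (Matrix.of fun i j : Fin 2 => if i.val + j.val + 1 = 2 then (1 : L) else 0)).Local v × (UnitaryGroup.cmDatum L 1 (Matrix.of fun i j : Fin 1 => if i.val + j.val + 1 = 1 then (1 : L) else 0)).Local v)) (W : Set ((UnitaryGroup.LocalRing L v) × (UnitaryGroup.LocalRing L v) × (UnitaryGroup.LocalRing L v))) (ψ : (UnitaryGroup.cmDatum L 2 (Matrix.of fun i j : Fin 2 => if i.val + j.val + 1 = 2 then (1 : L) else 0)).Local v × (UnitaryGroup.cmDatum L 1 (Matrix.of fun i j : Fin 1 => if i.val + j.val + 1 = 1 then (1 : L) else 0)).Local v → ℂ), IsOpen W ∧ c ∈ W ∧ IsLocSmooth ψ ∧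
      (∀ γ ∈ V, IsLocalGRegular L v γ → stableOrbitalIntegralRel (IsLocalStablyConjH L v) mH ψ γ =
        ∑ᶠ c : ConjClasses ((UnitaryGroup.cmDatum L 3 H').Local v), T.Δ γ (Quotient.out c) * classOrbitalIntegral mG φ c) ∧
      (∀ γ : (UnitaryGroup.cmDatum L 2 (Matrix.of fun i j : Fin 2 => if i.val + j.val + 1 = 2 then (1 : L) else 0)).Local v × (UnitaryGroup.cmDatum L 1 (Matrix.of fun i j : Fin 1 => if i.val + j.val + 1 = 1 then (1 : L) else 0)).Local v, IsLocalGRegular L v γ →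
        ((finCharpolyTwo L v γ).coeff 0, (finCharpolyTwo L v γ).coeff 1, finGammaTwo L v γ) ∈ W → ∃ γ' ∈ V, IsLocalStablyConjH L v γ γ') := by
    rintro ⟨c₀, c₁, u⟩ hc
    obtain ⟨h₀, h₁, hu⟩ := hKadm hc
    obtain ⟨εH, hss, hπ⟩ := exists_semisimple_classMapH_eq L v w hw c₀ c₁ u h₀ h₁ hu
    obtain ⟨V, hV, ψ, hψ, hVloc⟩ := hloc εH hss
    obtain ⟨W, hWo, hεW, hsat⟩ := exists_isOpen_classMapH_saturation L v w hw εH hV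
    exact ⟨V, W, ψ, hWo, hπ ▸ hεW, hψ, hVloc, hsat⟩
  obtain ⟨φH, hφH, hmain⟩ := exists_stableOrbitalIntegralRel_eq_of_pointwise_of_saturation (IsLocalStablyConjH L v) (IsLocalGRegular L v) mH
    (fun γH : (UnitaryGroup.cmDatum L 2 (Matrix.of fun i j : Fin 2 => if i.val + j.val + 1 = 2 then (1 : L) else 0)).Local v × (UnitaryGroup.cmDatum L 1 (Matrix.of fun i j : Fin 1 => if i.val + j.val + 1 = 1 then (1 : L) else 0)).Local v => ((finCharpolyTwo L v γH).coeff 0, (finCharpolyTwo L v γH).coeff 1, finGammaTwo L v γH))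
    (fun b y => by simp only [finCharpolyTwo_conj L v b y, finGammaTwo_conj L v b y])
    (fun a b _ hab => by simp only [finCharpolyTwo_eq_of_isLocalStablyConjH L v hab, finGammaTwo_eq_of_isLocalStablyConjH L v hab])
    (fun a b hab e => ⟨fun h => (IsStablyConjH.symm hab).trans h, fun h => hab.trans h⟩)
    (fun a b ha hab => isGRegular_of_isStablyConjH _ _ _ _ hab ha)
    IsLocSmooth isLocSmooth_zero (fun F G hF hG => hF.add hG)
    (fun ψ W hψ hWc hWo => hψ.indicator ⟨hWc.isClosed.preimage hπc, hWo.preimage hπc⟩)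
    (fun γH => ∑ᶠ c : ConjClasses ((UnitaryGroup.cmDatum L 3 H').Local v), T.Δ γH (Quotient.out c) * classOrbitalIntegral mG φ c)
    (fun a b _ hab => finsum_congr fun c => by rw [hT a b _ hab])
    K hK (fun a _ haK => by by_contra h; exact haK (hKR a h)) hloc'
  exact ⟨φH, hφH, hmain⟩

end Local

/-! ## §3 The registered stub, token-exact -/

/-- **STUB `stub_N6nsGlue` of the floor-2 line «N6nsGerm» (A-p12 (g18), crux H413), TOKEN-EXACT, PROVED**: «a local stable orbital integral is a stable
orbital integral» [Langlands–Shelstad 1990, Lemma 2.2.A] in transfer dress for `H_v = U(Φ₂)_v × U(Φ₁)_v → G′_v = U(H′)_v` at a place `v` with one place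
of `L` above it, for the explicit factor `Δ‴_v = (finExplicitCollection …) v` (stably invariant, ★ `finExplicitCollection_Δ_eq_of_isLocalStablyConjH`):
if `UnitaryGroup.LocalRing L vφ` is a local stable orbital integral at every `ε_H` with semisimple `U(1,1)`-part, then `φ` has a `Δ‴_v`-transfer `φ^H ∈ C_c^∞(H_v)`.  (The idle
hypotheses — Haar measures, unitarity and restriction of `μ`, hermitian-anisotropy of `H′`, canonicity — are those of the line's statement; the four instance binders are `_`-prefixed, an α-renaming of the line's statement, so `stub_N6nsGlue` closes by `exact stubN6nsGlue_of_hloc`.)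
[cite: LanglandsShelstad1990Descent, Lemma 2.2.A pp. 10–12] [cite: Rogawski1990, §4.3 (4.3.1) p. 43] -/
theorem stubN6nsGlue_of_hloc :
    ∀ (L : Type) [Field L] [NumberField L] [IsCMField L] (H' : Matrix (Fin 3) (Fin 3) L) (μ : HeckeCharacter L)
      [∀ v : HeightOneSpectrum (𝓞 ↥(maximalRealSubfield L)),
        MeasurableSpace ((UnitaryGroup.cmDatum L 2 (Matrix.of fun i j : Fin 2 => if i.val + j.val + 1 = 2 then (1 : L) else 0)).Local v ×
          (UnitaryGroup.cmDatum L 1 (Matrix.of fun i j : Fin 1 => if i.val + j.val + 1 = 1 then (1 : L) else 0)).Local v)]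
      [∀ v : HeightOneSpectrum (𝓞 ↥(maximalRealSubfield L)),
        BorelSpace ((UnitaryGroup.cmDatum L 2 (Matrix.of fun i j : Fin 2 => if i.val + j.val + 1 = 2 then (1 : L) else 0)).Local v ×
          (UnitaryGroup.cmDatum L 1 (Matrix.of fun i j : Fin 1 => if i.val + j.val + 1 = 1 then (1 : L) else 0)).Local v)]
      [∀ v : HeightOneSpectrum (𝓞 ↥(maximalRealSubfield L)), MeasurableSpace ((UnitaryGroup.cmDatum L 3 H').Local v)]
      [∀ v : HeightOneSpectrum (𝓞 ↥(maximalRealSubfield L)), BorelSpace ((UnitaryGroup.cmDatum L 3 H').Local v)]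
      (νH : ∀ v : HeightOneSpectrum (𝓞 ↥(maximalRealSubfield L)),
        Measure ((UnitaryGroup.cmDatum L 2 (Matrix.of fun i j : Fin 2 => if i.val + j.val + 1 = 2 then (1 : L) else 0)).Local v ×
          (UnitaryGroup.cmDatum L 1 (Matrix.of fun i j : Fin 1 => if i.val + j.val + 1 = 1 then (1 : L) else 0)).Local v))
      (νG : ∀ v : HeightOneSpectrum (𝓞 ↥(maximalRealSubfield L)), Measure ((UnitaryGroup.cmDatum L 3 H').Local v))
      [∀ v, (νH v).IsHaarMeasure] [∀ v, (νH v).IsMulRightInvariant] [∀ v, (νG v).IsHaarMeasure] [∀ v, (νG v).IsMulRightInvariant],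
      μ.IsUnitary →
      (∀ x : ideleGroup ↥(maximalRealSubfield L), μ (AdeleRing.ideleBaseChange (↥(maximalRealSubfield L)) L x) = quadraticHeckeCharCM L x) →
      (H'.map (cmConjRingHom L)).transpose = H' →
      (∀ x : Fin 3 → L, hermForm (cmConjRingHom L) H' x x = 0 → x = 0) →
      ∀ (v : HeightOneSpectrum (𝓞 ↥(maximalRealSubfield L))), Subsingleton (UnitaryGroup.PlacesOver L v) →
      ∀ [_iH : ∀ a : ((UnitaryGroup.cmDatum L 2 (Matrix.of fun i j : Fin 2 => if i.val + j.val + 1 = 2 then (1 : L) else 0)).Local v × (UnitaryGroup.cmDatum L 1 (Matrix.of fun i j : Fin 1 => if i.val + j.val + 1 = 1 then (1 : L) else 0)).Local v),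
          MeasurableSpace (((UnitaryGroup.cmDatum L 2 (Matrix.of fun i j : Fin 2 => if i.val + j.val + 1 = 2 then (1 : L) else 0)).Local v × (UnitaryGroup.cmDatum L 1 (Matrix.of fun i j : Fin 1 => if i.val + j.val + 1 = 1 then (1 : L) else 0)).Local v) ⧸
            Subgroup.centralizer ({a} : Set ((UnitaryGroup.cmDatum L 2 (Matrix.of fun i j : Fin 2 => if i.val + j.val + 1 = 2 then (1 : L) else 0)).Local v × (UnitaryGroup.cmDatum L 1 (Matrix.of fun i j : Fin 1 => if i.val + j.val + 1 = 1 then (1 : L) else 0)).Local v)))]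
        [_bH : ∀ a : ((UnitaryGroup.cmDatum L 2 (Matrix.of fun i j : Fin 2 => if i.val + j.val + 1 = 2 then (1 : L) else 0)).Local v × (UnitaryGroup.cmDatum L 1 (Matrix.of fun i j : Fin 1 => if i.val + j.val + 1 = 1 then (1 : L) else 0)).Local v),
          BorelSpace (((UnitaryGroup.cmDatum L 2 (Matrix.of fun i j : Fin 2 => if i.val + j.val + 1 = 2 then (1 : L) else 0)).Local v × (UnitaryGroup.cmDatum L 1 (Matrix.of fun i j : Fin 1 => if i.val + j.val + 1 = 1 then (1 : L) else 0)).Local v) ⧸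
            Subgroup.centralizer ({a} : Set ((UnitaryGroup.cmDatum L 2 (Matrix.of fun i j : Fin 2 => if i.val + j.val + 1 = 2 then (1 : L) else 0)).Local v × (UnitaryGroup.cmDatum L 1 (Matrix.of fun i j : Fin 1 => if i.val + j.val + 1 = 1 then (1 : L) else 0)).Local v)))]
        [_iG : ∀ γ : ((UnitaryGroup.cmDatum L 3 H').Local v), MeasurableSpace (((UnitaryGroup.cmDatum L 3 H').Local v) ⧸ Subgroup.centralizer ({γ} : Set ((UnitaryGroup.cmDatum L 3 H').Local v)))]
        [_bG : ∀ γ : ((UnitaryGroup.cmDatum L 3 H').Local v), BorelSpace (((UnitaryGroup.cmDatum L 3 H').Local v) ⧸ Subgroup.centralizer ({γ} : Set ((UnitaryGroup.cmDatum L 3 H').Local v)))]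
        (mH : OrbitalMeasureFamily ((UnitaryGroup.cmDatum L 2 (Matrix.of fun i j : Fin 2 => if i.val + j.val + 1 = 2 then (1 : L) else 0)).Local v × (UnitaryGroup.cmDatum L 1 (Matrix.of fun i j : Fin 1 => if i.val + j.val + 1 = 1 then (1 : L) else 0)).Local v))
        (mG : OrbitalMeasureFamily ((UnitaryGroup.cmDatum L 3 H').Local v)),
      mH.IsCanonical (IsLocalGRegular L v) (νH v) → mG.IsCanonical (fun γ => IsRegularElt (γ.val : GL (Fin 3) (UnitaryGroup.LocalRing L v))) (νG v) →
      ∀ (φ : ((UnitaryGroup.cmDatum L 3 H').Local v) → ℂ), IsLocSmooth φ →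
      (∀ εH : ((UnitaryGroup.cmDatum L 2 (Matrix.of fun i j : Fin 2 => if i.val + j.val + 1 = 2 then (1 : L) else 0)).Local v × (UnitaryGroup.cmDatum L 1 (Matrix.of fun i j : Fin 1 => if i.val + j.val + 1 = 1 then (1 : L) else 0)).Local v),
        (IsRegularElt (εH.1.val : GL (Fin 2) (UnitaryGroup.LocalRing L v)) ∨ ∃ a : (UnitaryGroup.LocalRing L v), (εH.1.val.val : Matrix (Fin 2) (Fin 2) (UnitaryGroup.LocalRing L v)) = a • (1 : Matrix (Fin 2) (Fin 2) (UnitaryGroup.LocalRing L v))) →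
        ∃ V ∈ 𝓝 εH, ∃ φH : ((UnitaryGroup.cmDatum L 2 (Matrix.of fun i j : Fin 2 => if i.val + j.val + 1 = 2 then (1 : L) else 0)).Local v × (UnitaryGroup.cmDatum L 1 (Matrix.of fun i j : Fin 1 => if i.val + j.val + 1 = 1 then (1 : L) else 0)).Local v) → ℂ, IsLocSmooth φH ∧
          ∀ γH ∈ V, IsLocalGRegular L v γH →
            stableOrbitalIntegralRel (IsLocalStablyConjH L v) mH φH γH =
              ∑ᶠ c : ConjClasses ((UnitaryGroup.cmDatum L 3 H').Local v), ((finExplicitCollection L H' μ (finExplicitDelta_conj_left_all L H' μ) (finExplicitDelta_conj_right_all L H' μ)) v).Δ γH (Quotient.out c) * classOrbitalIntegral mG φ c) →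
        ∃ φH : ((UnitaryGroup.cmDatum L 2 (Matrix.of fun i j : Fin 2 => if i.val + j.val + 1 = 2 then (1 : L) else 0)).Local v × (UnitaryGroup.cmDatum L 1 (Matrix.of fun i j : Fin 1 => if i.val + j.val + 1 = 1 then (1 : L) else 0)).Local v) → ℂ, IsLocSmooth φH ∧
          IsLocalDeltaTransfer L H' v ((finExplicitCollection L H' μ (finExplicitDelta_conj_left_all L H' μ) (finExplicitDelta_conj_right_all L H' μ)) v) mH mG φH φ := by
  intro L _ _ _ H' μ _ _ _ _ _ _ _ _ _ _ _ _ _ _ v _ _ _ _ _ mH mG _ _ φ hφ hloc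
  obtain ⟨w⟩ := UnitaryGroup.PlacesOver.nonempty L v
  have hw : IsCMField.complexConj L • w.1 = w.1 := by
    have hmem : (IsCMField.complexConj L • w.1).under (𝓞 ↥(maximalRealSubfield L)) = v := by
      rw [HeightOneSpectrum.under_algEquiv_smul]; exact w.2
    exact congrArg Subtype.val (Subsingleton.elim (⟨IsCMField.complexConj L • w.1, hmem⟩ : UnitaryGroup.PlacesOver L v) w)
  exact exists_isLocalDeltaTransfer_of_locally L H' v w hw _
    (fun a a' b h => finExplicitCollection_Δ_eq_of_isLocalStablyConjH L v H' μ (finExplicitDelta_conj_left_all L H' μ)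
      (finExplicitDelta_conj_right_all L H' μ) h b)
    mH mG φ hφ hloc

end Literature.NumberTheory.Rogawski1990

end
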